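import Mathlib
import HarnessLib
import HarnessLib.Audit
import Summits.AnomalousDissipation.Statement
import Literature.Analysis.FluidPDE.StatisticalSolution
import Literature.Analysis.FluidPDE.LerayHopf
import Literature.Analysis.FluidPDE.TimeAverageLiouville
import Literature.Analysis.FluidPDE.DoeringFoiasProofs
import HarnessLib.Audit.Status.Attr

/-!
Route: PumpedMirror

# Route PumpedMirror — certificates in the pumped mirror class — Kelvin's circulation law strips
f_TG of its dodgers, a K-floor below a rest-ceiling decides

RECOMBINATION (lens recomb, cycle 1). Work in the Taylor–Green MIRROR CLASS Fix K on T³ (fields with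
u(R_i x) = R_i u(x) for the three
coordinate reflections R_i : x_i ↦ −x_i; torus side `Function.update x i (-x i)`, vector side
coordinatewise `u (Function.update x i (-x i)) j = if j = i then -(u x j) else u x j` (=
`mirrorReflection i` of OctahedralSymmetry, stated without that import since rev 1);
invariant under NS_ν for forces in Fix K, zero momentum by parity) with the PINNED Taylor–Green
force
f_TG = (sin2πx₀ cos2πx₁ cos2πx₂, −cos2πx₀ sin2πx₁ cos2πx₂, 0) ∈ Fix K (MirrorVariety's `tgForce`,
inlined verbatim as `∀ f, f = f_TG → …`).
It suffices to show X = MirrorCertificateTG = A ∧ B at one energy level E: (A, MirrorFloorTG) for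
every small ν ONE cylindrical test
functional Φ₁ and weight θ₁ ≤ 0 give the Taylor floor ε₀ ≤ ν‖∇u‖² + ⟨F(u),Φ₁'(u)⟩ + 2θ₁((u,f_TG) −
ν‖∇u‖²) at EVERY finite-enstrophy
K-symmetric state of H with |u|² ≤ E; (B, MirrorBoundedFromRestTG) for every small ν SOME global
Leray–Hopf solution of NS_ν(f_TG) FROM REST
whose H-lift stays in Fix K keeps |u(t)|² ≤ E for all t ≥ 0. Cards realised:
kelvin-pump-symmetry-skeleton (spine: its identity K1 becomes the
supports KelvinPumpSteadyTG / NoSmoothMirrorDodgerTG, its "summit in K" becomes A ∧ B),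
kida-high-symmetry-arena-rigid-skeleton (its
proposal "run the certificate programme in a symmetric arena first", specialised to the one arena
where Kelvin pumps). Banked pieces:
TaylorCertificates' PROVED FloorTransfer (adapted to a set: the support FloorTransferOnSetTG, proof
sketch checked by the planner) and ZeroDatumLerayHopf shape; MirrorVariety's
arena and landed force facts; FrustratedForces'/TaylorCertificatePair's refutation lessons (no
pointwise or universal ceiling; rest datum).
Lean: `∀ f : UnitAddTorus (Fin 3) → EuclideanSpace ℝ (Fin 3), f = (fun x => !₂[(fourier 1 (x 0) :
ℂ).im * (fourier 1 (x 1) : ℂ).re * (fourier 1 (x 2) : ℂ).re, -((fourier 1 (x 0) : ℂ).re * (fourier 1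
(x 1) : ℂ).im * (fourier 1 (x 2) : ℂ).re), (0 : ℝ)]) → ∃ (E ε₀ ν₀ : ℝ), 0 < E ∧ 0 < ε₀ ∧ 0 < ν₀ ∧ ∀
ν : ℝ, 0 < ν → ν < ν₀ → (∃ (Φ₁ : Literature.Analysis.FluidPDE.Torus.CylindricalTest (Fin 3)) (θ₁ :
ℝ), θ₁ ≤ 0 ∧ ∀ u : Literature.Analysis.FunctionSpaces.Torus.energySpace (Fin 3), let uf :
UnitAddTorus (Fin 3) → EuclideanSpace ℝ (Fin 3) := ((u : MeasureTheory.Lp (EuclideanSpace ℝ (Fin 3))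
2 (MeasureTheory.volume : MeasureTheory.Measure (UnitAddTorus (Fin 3)))) : UnitAddTorus (Fin 3) →
EuclideanSpace ℝ (Fin 3)); let D : ℝ := ν * (Literature.Analysis.FunctionSpaces.Torus.eGradNormSq
uf).toReal; let P : ℝ := Literature.Analysis.FluidPDE.Torus.pairing (u : MeasureTheory.Lp
(EuclideanSpace ℝ (Fin 3)) 2 (MeasureTheory.volume : MeasureTheory.Measure (UnitAddTorus (Fin 3))))
f - D; (∀ i j : Fin 3, (fun x => uf (Function.update x i (-x i)) j) =ᵐ[MeasureTheory.volume] (fun x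
=> if j = i then -(uf x j) else uf x j)) → Literature.Analysis.FunctionSpaces.Torus.eGradNormSq uf ≠
⊤ → ‖u‖ ^ 2 ≤ E → ε₀ ≤ D + Literature.Analysis.FluidPDE.Torus.nsGeneratorPairing ν f u (Φ₁.grad u) +
2 * θ₁ * P) ∧ (∃ (u : ℝ → UnitAddTorus (Fin 3) → EuclideanSpace ℝ (Fin 3)) (U : ℝ →
Literature.Analysis.FunctionSpaces.Torus.energySpace (Fin 3)),
Literature.Analysis.FluidPDE.Torus.IsGlobalLerayHopf ν (fun _ => f) 0 u ∧ (∀ t, 0 ≤ t → ((U t :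
MeasureTheory.Lp (EuclideanSpace ℝ (Fin 3)) 2 (MeasureTheory.volume : MeasureTheory.Measure
(UnitAddTorus (Fin 3)))) : UnitAddTorus (Fin 3) → EuclideanSpace ℝ (Fin 3)) =ᵐ[MeasureTheory.volume]
u t) ∧ (∀ t, 0 ≤ t → ∀ i j : Fin 3, (fun x => ((U t : MeasureTheory.Lp (EuclideanSpace ℝ (Fin 3)) 2
(MeasureTheory.volume : MeasureTheory.Measure (UnitAddTorus (Fin 3)))) : UnitAddTorus (Fin 3) →
EuclideanSpace ℝ (Fin 3)) (Function.update x i (-x i)) j) =ᵐ[MeasureTheory.volume] (fun x => if j =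
i then -(((U t : MeasureTheory.Lp (EuclideanSpace ℝ (Fin 3)) 2 (MeasureTheory.volume :
MeasureTheory.Measure (UnitAddTorus (Fin 3)))) : UnitAddTorus (Fin 3) → EuclideanSpace ℝ (Fin 3)) x
j) else ((U t : MeasureTheory.Lp (EuclideanSpace ℝ (Fin 3)) 2 (MeasureTheory.volume :
MeasureTheory.Measure (UnitAddTorus (Fin 3)))) : UnitAddTorus (Fin 3) → EuclideanSpace ℝ (Fin 3)) x
j)) ∧ (∀ t, 0 ≤ t → ‖U t‖ ^ 2 ≤ E))`

## Assembly
`closes : MirrorFloorTG → MirrorBoundedFromRestTG → AnomalousDissipation` is PROVED in glue.lean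
(rev 2, ≈185 lines / 11.9 k chars, crux-only hypotheses;
axioms propext/Classical.choice/Quot.sound; Sketch6.lean rc 0 in 16 s with imports Statement +
StatisticalSolution + LerayHopf +
TimeAverageLiouville + DoeringFoiasProofs only): ν_j := min(ν₀,ν₁)/(j+2); for each j crux #3 gives
the K-symmetric Leray–Hopf path from
rest with lift in Fix K ∩ {‖U t‖² ≤ E}; crux #2 at level E gives (Φ₁,θ₁); the floor transfer
(TaylorCertificates' PROVED `FloorTransfer`
with the floor assumed only on the SET of mirror states of energy ≤ E that the lift never leaves;
recorded as the reusable support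
FloorTransferOnSetTG) is proved INSIDE `closes` from
`IsLerayHopfOn.intervalIntegral_dissipation_le/_eq`, `aemeasurable_eGradNormSq`,
`IsLerayHopfOn.intervalIntegrable_power/intervalIntegral_power_bounds` (running-mean dissipation
bound), `IsGlobalLerayHopf.integrableOn_generator/tendsto_timeMean_generator`, `pairing_lift_eq`,
giving
ε₀ ≤ meanDissipation; meanEnergy ≤ E from the pathwise lift bound (‖U t‖² = ∫|u t|², Cesàro means ≤
E in the junk-safe sense,
limsup ≤ E); force regularity is proved INSIDE `closes` over `FunctionSpaces.TorusTrigPoly` only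
(f_TG = realTrigPoly on the shell {±1}³
with coefficients (i/8)(−k₀,k₁,0): `isSmooth_realTrigPoly`, `isDivFree_realTrigPoly` from
transversality, zero mean from `integral_mFourier`;
adapted from MirrorVariety's landed Negative/Anatomy; recorded as the support
TaylorGreenForceRegularTG).
CONE NOTE (route-repair 2026-08-16, revs 1–2): rev 0 imported
`Theorems/TaylorCertificatesFloorTransfer` (→ the whole TaylorCertificates
thesis cone: SteadyNavierStokes*, StokesTorus, SymmetricPMap …), MirrorVariety's `Negative/Anatomy`
(→ Theses.MirrorVariety, SteadyGalerkinApprox …)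
and `OctahedralSymmetry` (→ SelfSimilar → MildSolution) — 129 project modules with 7 unproved named
facts in the MODULE cone, none used by
any item (gate used-constants cone 0/61 unproved). Revs 1–2 cut the imports to the four
statement/transfer modules (74 modules) and write the
K-symmetry clauses coordinatewise (`u (update x i (-x i)) j = if j = i then -(u x j) else u x j`, ≡
`mirrorReflection_apply`). What REMAINS in
the module cone is Literature-internal and cannot be removed at route level: `NSLerayHopf`
(LerayHopfNonUniqueness, EnergyClassNonUniqueness —
both @[conjecture] — and albritton_brue_colombo, XL) + `NSWave0` (summit-grade NS conjectures) enter
through `NSHopfGalerkin → NSLerayHopf`,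
which every Leray–Hopf time-average tool imports
(LerayHopfTimeSliceTorus/CylindricalGenerator/TimeAverageLiouville/DoeringFoiasProofs), and
`Vorticity` (IsVorticitySolutionOn.exists_pressure, S) through `LerayHopfProofs →
ClassicalSolutionCalculus → TaoEnstrophyLocalisation →
TaoLocalisation → NSVorticity → Vorticity`. None is needed by this route; the fix is a librarian
split of NSLerayHopf.lean's open/XL facts into
a leaf module and a discharge (or move) of `exists_pressure` — the same collateral sits in the
module cone of TaylorCertificates, MirrorVariety and
every other Leray–Hopf route of the summit.

Rationale: WHY THIS LINE. Every floor certificate on this summit has died at a SLOW QUIET STATE: smooth quiet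
Euler points P[(v·∇)v] = f kill all band-limited floors of
degree ≤ Cν^{-β}, β < 1 (landed `KolmogorovFloor/Negative/QuietPointKill`, `CheapBaseKill`; explicit
smooth dodgers for Kolmogorov, designer
and two-Beltrami forces, `Cruxes/SmoothEulerCoerciveForce/KolmogorovSmoothDodger.md`,
`Negative/TaylorGreenDesignerForce`), far shear states
and unresolved beats kill pointwise ceilings (`TaylorCertificatesTaylorCertificatePairRefutation`),
Galilean drift kills universal energy
ceilings and rest-free family statements (negatives 2979, 2984, 2859). In Fix K none of these
objects exists, and for f_TG the first one
is excluded by a THEOREM rather than a hope: Kelvin's circulation law on the symmetry-pinned face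
loop C = ∂([0,½]²×{x₂=0}) (edges are
invariant lines, corners permanent stagnation points) reads dΓ_C/dt = ∮_C f_TG·dl + ν∮_C Δu·dl with
∮_C f_TG·dl = 4/π ≠ 0 and NO advective
term for every smooth K-symmetric field (each edge integral of (u·∇)u is [u_s²/2] between stagnation
corners), so (i) no smooth K-symmetric
forced-Euler steady state of f_TG exists at any energy (the quiet-point killer has no instance),
(ii) every steady K-state obeys the exact
ν-independent identity ν∮_CΔu·dl = −4/π, (iii) shear flows, Beltrami/ABC rays, drifts and 2½-D
scalar carriers are not in Fix K by parity
(transplant of the wind-driven-gyre boundary-streamline constraint, doi:10.1357/002224004774201681,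
Batchelor 1956 doi:10.1017/S0022112056000123,
to the forced 3-D TG class; TG symmetries: doi:10.1017/s0022112083001159). Imported areas:
auxiliary-functional / SOS bounds for time
averages and their minimax duality (arXiv:1705.07096, arXiv:2010.06730, doi:10.1098/rsta.2013.0350),
symmetry reduction of such bounds
(doi:10.1088/1361-6544/ab018b), statistical-solution transfer (FMRTTurbulence2001 Ch. IV). What no
prior route does: TaylorCertificates
quantifies its floor over the whole Leray ball |u|² ≤ 16‖f‖²/ν² for an unspecified f and couples it
to a UNIVERSAL ensemble ceiling
(heuristically contradictory with log-quiet bounded steady branches); here the floor is asked only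
below the FIXED level E of the family
from rest, the ceiling only along that family, the force is pinned, and the state space is cut to
the one invariant class where the recorded
killers are provably absent; MirrorVariety uses Fix K for steady Galerkin Newton data only.

RANKED CRUXES. #0 MirrorCertificateTG (target) — X = A ∧ B at one common energy level E and
viscosity threshold (for f = f_TG): low-energy mirror floor certificate for every ν < ν₀ AND a
mirror-symmetric global Leray–Hopf solution from rest staying in {|u|² ≤ E} for every ν < ν₀. (why
it might fail: the two halves pull apart: a quiet bounded invariant K-state below the energy level
reached from rest kills A at every E ≥ its energy, while B needs E at least the peak energy of the
transient from rest.) [arXiv:1705.07096, arXiv:2010.06730, doi:10.1017/s0022112083001159,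
doi:10.1103/physreve.77.036306]
#2 MirrorFloorTG (crux) — LOW-ENERGY MIRROR FLOOR (from TaylorCertificates: the floor certificate
and its PROVED pathwise transfer; from kelvin-pump-symmetry-skeleton: the class where smooth dodgers
cannot exist; new statement). For f = f_TG and EVERY energy level E > 0 there are ε₀, ν₀ > 0 such
that for every ν ∈ (0,ν₀) ONE cylindrical test functional Φ₁ and weight θ₁ ≤ 0 satisfy ε₀ ≤ ν‖∇u‖² +
⟨F(u),Φ₁'(u)⟩ + 2θ₁((u,f_TG) − ν‖∇u‖²) at every finite-enstrophy state u ∈ H that is K-symmetric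
(a.e., on its representative) with |u|² ≤ E. By minimax (Tobasco–Goluskin–Doering; Rosa–Temam) this
says: at small ν every (Galerkin-)invariant K-law of f_TG carried below energy E is ε₀(E)-loud — in
particular NO bounded quiet steady or recurrent K-state exists. [difficulty: open-problem] (why it
might fail: ONE quiet bounded invariant K-state kills it: a steady corner line-jet of width √ν
carrying the Kelvin flux 4/π at dissipation O(ν) (card K3's failure mode), a steady branch shadowing
A(ν)·(planar TG cell) with A ~ ν^{-1/3}, or quiet eruption cycles below energy E.)
[arXiv:1705.07096, arXiv:2010.06730, FMRTTurbulence2001, doi:10.1098/rsta.2013.0350,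
doi:10.1017/s0022112083001159, doi:10.1357/002224004774201681]
#3 MirrorBoundedFromRestTG (crux) — BOUNDED MIRROR FAMILY FROM REST (from
FrustratedForces/DebrisQuanta/TaylorCertificatePair refutations: the way of failing to avoid — no
universal ceiling, no free datum, no drift; from TaylorCertificates: ZeroDatumLerayHopf's
lift-in-a-ball shape; new statement). For f = f_TG there are E, ν₁ > 0 such that for every ν ∈
(0,ν₁) SOME global Leray–Hopf solution of NS_ν(f_TG) from the zero datum, with an H-lift U (U t = u
t a.e., t ≥ 0) whose representatives are K-symmetric a.e., satisfies ‖U t‖² ≤ E for all t ≥ 0 — a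
PATHWISE, ν-uniform energy bound for the Taylor–Green flow started from rest inside its symmetry
class (zero momentum automatic; the only ν-independent energy scale is F·L, the transient u ≈ t f_TG
saturates at t ≈ F^{-1/2}). [difficulty: open-problem] (why it might fail: no ν-uniform sup-in-time
energy bound is known for ANY fixed 3-D force, even from rest (a priori 16‖f‖²/ν² only); a
transition delayed like log(1/ν), or a fat K-attractor (laminar-type branch E ~ ν^{-2a}) reached
from rest, breaks it.) [DoeringFoias2002, FMRTTurbulence2001, doi:10.1103/physreve.77.036306,
doi:10.1016/0169-5983(91)90026-f, arXiv:2311.04182]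
#9 NoSmoothMirrorDodgerTG (support) — KELVIN PUMP ⇒ NO SMOOTH MIRROR DODGER (card
kelvin-pump-symmetry-skeleton K1, corollary (1); provable now, M): no smooth divergence-free
K-symmetric v satisfies ∫⟪(v·∇)v − f_TG, w⟫ = 0 for all smooth divergence-free mean-zero w. Proof:
the weak identity gives (v·∇)v − f_TG = ∇p + c with p smooth (landed stub_strongForm p89280) and c
constant; integrate the tangential component around C = ∂([0,½]²×{x₂=0}): on each edge v is tangent
(normal components odd ⇒ 0) so ((v·∇)v)·t = ∂_s(v_s²/2) and v_s vanishes at the corners (odd +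
1-periodic ⇒ v_s(½)=0), ∮∇p·dl = ∮c·dl = 0, but ∮ f_TG·dl = 4·(1/π) ≠ 0. This is exactly the
hypothesis `hquiet` of `KolmogorovFloor/Negative/QuietPointKill.floor_no_quiet_point` that can
therefore never be met inside Fix K for f_TG. [difficulty: provable-now]
[doi:10.1357/002224004774201681, doi:10.1017/S0022112056000123, doi:10.1017/s0022112083001159]
#9 KelvinPumpSteadyTG (support) — KELVIN PUMP IDENTITY FOR STEADY MIRROR STATES (card K1 (2), steady
case; provable now, M): for every ν and every smooth K-symmetric steady classical state (u,p) of
NS_ν(f_TG) (time-constant `IsClassicalNSSolutionOn univ`), ν·∮_C Δu·dl = −∮_C f_TG·dl = −4/π, the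
loop integral written as four interval integrals over s ∈ (0,½) of the tangential components of Δu
along the edges {x₁=x₂=0}, {x₀=½,x₂=0}, {x₁=½,x₂=0} (reversed), {x₀=0,x₂=0} (reversed). The first
exact ν-independent viscous identity of the fixed-force problem in this class: every steady K-state
carries 1/ν curvature on the skeleton (a quiet bounded steady branch, if any, is a
singular-perturbation object located in advance). Same proof as NoSmoothMirrorDodgerTG plus the
viscous term. [difficulty: provable-now] [doi:10.1357/002224004774201681,
doi:10.1017/S0022112056000123, doi:10.1017/jfm.2018.54]
#9 MirrorSteadyStatesLoudTG (support) — LOW-ENERGY STEADY MIRROR STATES ARE LOUD — the cheapest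
necessary condition of crux #2, typed for refuters and for K-symmetric Newton continuation (special
case; TaylorCertificates' TargetImpliesSteady pattern: at a smooth steady state the generator
pairing and the energy channel vanish, so the floor reads ε₀ ≤ ν‖∇u‖²): for f = f_TG and every E > 0
there are ε₀, ν₀ > 0 such that for ν ∈ (0,ν₀) every smooth divergence-free pointwise-K-symmetric u
solving the tested steady equations ∫⟪νΔu − (u·∇)u + f_TG, w⟫ = 0 (w smooth div-free mean-zero) with
∫|u|² ≤ E has ν‖∇u‖² ≥ ε₀. By KelvinPumpSteadyTG its quiet failure mode cannot be a ν-uniformly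
smooth branch. [difficulty: L] [arXiv:1705.07096, doi:10.1017/s0022112083001159, Temam1979]
#9 CruxesGiveTargetTG (support) — glue, PROVED in the planner's Sketch.lean
(`cruxesGiveTarget_holds`, 6 lines): MirrorFloorTG → MirrorBoundedFromRestTG → MirrorCertificateTG
(take E, ν₁ from B, instantiate A at E, ν₀ := min). [difficulty: provable-now] [arXiv:1705.07096]
#9 FloorTransferOnSetTG (support) — FLOOR TRANSFER ON A SET (provable now, M; rev 1 cone repair):
for ν > 0, a smooth steady force f, θ₁ ≤ 0, a cylindrical Φ₁ and ANY set S ⊆ H: if the floor ε₀ ≤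
ν‖∇v‖² + ⟨F(v),Φ₁'(v)⟩ + 2θ₁((v,f) − ν‖∇v‖²) holds at every finite-enstrophy v ∈ S with |v|² ≤ ρ,
then every global Leray–Hopf solution of NS_ν(f) from rest whose H-lift stays in S ∩ {|v|² ≤ ρ} has
ε₀ ≤ meanDissipation ν u (energy inequality from the zero datum ∫D ≤ ∫P, |P| ≤ √ρ‖f‖₂, generator
Cesàro mean → 0 by the chain rule for the bounded Φ₁, limsup comparison). This is
TaylorCertificates' PROVED `FloorTransfer` (Theorems/TaylorCertificatesFloorTransfer.lean) with the
ball replaced by a set; it is proved INLINE in the rev-2 `closes` (crux-only deciding theorem) and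
recorded here as the reusable lemma a prover can land in one file (the planner's checked 120-line
proof is attached to the item as evidence). [difficulty: provable-now] [FMRTTurbulence2001,
arXiv:1705.07096, DoeringFoias2002]
#9 TaylorGreenForceRegularTG (support) — f_TG IS AN ADMISSIBLE FORCE (provable now, S; rev 1 cone
repair): f_TG is smooth, divergence free and mean zero (real trigonometric polynomial on the shell
{±1}³ with transversal conjugate-symmetric coefficients; landed as `isSmooth_tgForce`,
`isDivFree_tgForce`, `hasZeroMean_tgForce` in
Theorems/TaylorGreenLoudGalerkinStates/Negative/Anatomy.lean, same lambda term, and re-proved inline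
in the rev-2 `closes` over TorusTrigPoly; 3-line proof attached as evidence). [difficulty:
provable-now] [doi:10.1017/s0022112083001159, Temam1979]

TWO-LAYER PLAN. MirrorFloorTG ⇐ (MirrorSteadyFloor: the floor restricted to a √ν-neighbourhood of
the steady K-states / their absence below E) → (MirrorRecurrentFloor: a
certificate on the complement, where |F(u)| is bounded below) → MirrorFloorTG, k = 2, once
MirrorSteadyStatesLoudTG is decided by K-symmetric
continuation numerics. MirrorBoundedFromRestTG ⇐ (MirrorLhFromRest: K-symmetric Leray–Hopf existence
from rest with lift in Fix K, routine Galerkin-in-Fix-K,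
cf. landed symmetricLhExistence_proof / ZeroDatumLerayHopf_proof) → (MirrorTransientCeiling: sup_t
energy of THAT construction ≤ E uniformly in ν) →
MirrorBoundedFromRestTG, k = 2.

KILL CRITERIA. A bounded quiet invariant K-state of NS_ν(f_TG) along ν_j → 0 (steady corner line-jet
branch, planar-cell-shadow branch, quiet periodic K-orbit) refutes
MirrorFloorTG for every E above its energy: close `refuted:MirrorFloorTG` unless its energy exceeds
the level reached from rest (then restate A below that
level — one pre-registered pivot, no other). ¬MirrorSteadyStatesLoudTG proved ⇒ same. A K-symmetric
family from rest with sup_t energy → ∞ (delayed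
transition, fat K-attractor) refutes MirrorBoundedFromRestTG: close
`refuted:MirrorBoundedFromRestTG` (the route has no datum freedom to retreat to by
design). TaylorCertificates' KolmogorovFloor proved for a force in Fix K, or MirrorVariety's
TaylorGreenLoudGalerkinStates proved, moot/supersede parts
of this route (shared arena); SteadyNeg (0222) proved does NOT kill it (the witnesses here are
unsteady paths from rest).

NOT DECOMPOSED YET. The K-symmetric Leray–Hopf existence from rest (folded into crux #3 as its
routine first layer); the unsteady Kelvin identity dΓ_C/dt = 4/π + ν∮Δu·dl for
classical K-solutions and its time-averaged form for invariant K-laws (needs line traces of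
Galerkin/strong solutions; filed later as support of #2);
band-limited / Kolmogorov-resolution sharpenings of the floor (N ≍ ν^{-3/4}; only after the
approximate-dodger estimate den ≳ ν^{1/2} is made a lemma);
the corner line-jet boundary-layer problem (existence/non-existence of the steady edge layer: the
analytic heart of MirrorSteadyStatesLoudTG); Galerkin-level
twins of every item in MirrorVariety's `IsSteadyState` vocabulary.

CHEAPEST FALSIFIER. (i) Smooth K-dodger of f_TG: IMPOSSIBLE (∮_C f_TG·dl = 4/π computed by hand:
four edges × 1/π; advective edge integrals vanish by parity) — the catalogued
quiet-point kill has no instance. (ii) Next cheapest, a refuter's day in MirrorVariety's existing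
Fix-K Galerkin machinery: deflated Newton / ν-continuation
census of steady K-symmetric Galerkin states of f_TG at N ≤ 24, ν ∈ [10⁻³, 10⁻¹]: a branch with
∫|U|² bounded and ν‖∇U‖² → 0 (quiet bounded) is evidence
against #2 (and a typed target: ¬MirrorSteadyStatesLoudTG); all branches running away in energy or
staying loud supports #2. (iii) For #3: symmetric TG
DNS from rest (Brachet-type code, 256³ effective) at three viscosities, recording sup_t ∫|u|²:
growth of the peak with 1/ν kills #3. Not run this cycle
(planner seat; kit not used).

NUMBERS. ∮_C f_TG·dl = 4/π on the unit torus (each edge ∫₀^{1/2} sin 2πs ds = 1/π); ∫|f_TG|² = 1/4,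
Δf_TG = −12π²f_TG (MirrorVariety Negative/Anatomy); laminar
Stokes response f_TG/(12π²ν): energy 1/(4·144π⁴ν²), NOT a steady state (Λ(f_TG) = 2π·(π/8-shell-8
pattern) ≠ 0), Γ_C = 4/(12π³ν). Leray ball from rest:
‖U t‖² ≤ 16‖f‖²/ν² = 4/ν² (ZeroDatumLerayHopf). Approximate-dodger estimate (planner, NOTES): a
K-field with Euler defect confined to a tube of radius ρ
around the skeleton has CheapBaseKill denominator den ≳ νΔa/ρ² + Fρ ≥ c ν^{1/3} (free ρ) and ≍
ν^{1/2} in the self-consistent corner-layer scaling, so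
the kill condition den·32π²(1+2Θ)ν(4N+1)² ≤ ε₀/3 fails for N ≳ ν^{-3/4}.

DEFINITION REQUESTS. None needed to type the items (mirror class inlined via `Function.update x i
(-x i)` on the torus side and, since rev 1, coordinatewise `… j = if j = i then -(u x j) else u x j`
on the vector side — no `OctahedralSymmetry` import; line
integrals as interval integrals of edge traces). A named `Torus.IsMirrorSymmetric` / face-loop
circulation functional in Literature/Analysis/FunctionSpaces
would shorten every item (requested informally by card kelvin-pump-symmetry-skeleton; not
load-bearing).

Novelty: Searches (2026-08-16): `lit frontier AnomalousDissipation --since 2021` (30 rows: non-uniqueness /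
convex integration / passive scalars; none on
symmetry-class certificates); `lit search --source crossref` ×5 ("sum of squares bounds time
averages symmetry reduction invariant subspace Navier-Stokes" →
FMRT Ch. IV, Fushchych symmetry reduction; "Goluskin Fantuzzi Kuramoto-Sivashinsky semidefinite" →
doi:10.1088/1361-6544/ab018b; "Mininni Alexakis Pouquet
Taylor-Green forcing" → doi:10.1103/physreve.77.036306; "Brachet small-scale structure Taylor-Green"
→ doi:10.1017/s0022112083001159,
doi:10.1016/0169-5983(91)90026-f; "Chernyshenko … sum of squares fluid dynamics" →
doi:10.1098/rsta.2013.0350); `lit search --source arxiv` ("auxiliary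
functions bounds time averages sharp Tobasco Goluskin Doering" → arXiv:1705.07096, arXiv:2010.06730;
two further arxiv queries and openalex rate-limited
429, recorded); `lit galaxy search "Taylor-Green symmetries impermeable" / "Taylor-Green vortex
symmetries" / "sum-of-squares" --star all/pdf` (0 hits);
`lit search --hybrid` (local searchd connection reset ×2); `ledger negatives --problem
AnomalousDissipation` (6); all 42 Theses headers, 37 open Ideas,
the crux workfiles of KolmogorovFloor / TaylorCertificatePair / SmoothEulerCoerciveForce /
FloorCertificate (no symmetry-class restriction of a certificate
anywhere; card kelvin-pump's own audit: gyre literature doi:10.1357/002224004774201681).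
Nearest prior art found: doi:10.1088/1361-6544/ab018b  [refs: 10.1088/1361-6544/ab018b, 10.1103/physreve.77.036306, 10.1017/s0022112083001159, 10.1016/0169-5983(91, 10.1098/rsta.2013.0350, 10.1357/002224004774201681, 1705.07096, 2010.06730, doi:10.1088/1361-6544/ab018b, doi:10.1103/physreve.77.036306, doi:10.1017/s0022112083001159, doi:10.1016/0169-5983, doi:10.1098/rsta.2013.0350, doi:10.1357/002224004774201681]

Barriers (technique_class: lyapunov-certificate, symmetry-class, kelvin-pump): - technique_class: lyapunov-certificate, symmetry-class, kelvin-pump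
- Literature.Barriers.AnomalousDissipation.Cheskidov2023_thm13_not_forceRobustNoAnomaly: blocks
force-robust NO-anomaly proofs; crux #2 is a positive floor EXACT in f_TG (the certificate pairs the
generator with f_TG itself; its cheapest-falsifier analysis uses ∮f_TG·dl = 4/π exactly), crux #3 is
an existence statement — neither is in the class. Conceded: a proof of #3 by energy methods alone is
impossible (they give 4/ν²); #3 needs dynamics of the TG transient.
- Literature.Barriers.AnomalousDissipation.Marchioro1986_globalAttraction: gravest-shell PLANAR
forcing is enslaved to its laminar state; f_TG is gravest-shell but 3-D, its Stokes response is not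
a steady state (Λ(f_TG) ≠ 0) and Fix K contains no smooth resonant skeleton (Kelvin pump), so the
enslaving functional has no target; honest dependence: an unknown 3-D Marchioro-type fat attractor
in Fix K would refute #3.
- Literature.Barriers.AnomalousDissipation.AlexakisDoering2006_energyDissipationBound: the
x₂-invariant members of Fix K are planar TG cells with u₂ ≡ 0; they are NOT invariant under
NS_ν(f_TG) (f_TG ∝ cos 2πx₂) and at them the simplest certificate Φ = c(u,f_TG) has margin c‖f_TG‖²
((cell·∇cell, f_TG) = (cell, f_TG) = 0 by the x₂-average): planar states are neither witnesses nor
killers here.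
- Literature.Barriers.AnomalousDissipation.BuckmasterVicol2019_thm13: convex-integration (non-Leray)
solutions are outside the Leray–Hopf class of #3

History (route lifecycle, newest last):
- 2026-08-16T15:34:50Z · rev 1: restated MirrorCertificateTG (stmt-AnomalousDissipation-15550), MirrorFloorTG (stmt-AnomalousDissipation-15551), MirrorBoundedFromRestTG (stmt-AnomalousDissipation-15552), NoSmoothMirrorDodgerTG (stmt-AnomalousDissipation-15553), KelvinPumpSteadyTG (stmt-AnomalousDissipation-15554), MirrorSteadyStatesLoudTG (stm (planner-rrepair-AnomalousDissipation-PumpedMir-f9e8cabf-0)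

sub-problem: AnomalousDissipation · status: open · opened planner-plan-lens-AnomalousDissipation-recomb-0 2026-08-16T15:13:01Z · rev 2 · ledger route-AnomalousDissipation-PumpedMirror
GENERATED by the gate from the ledger (D-0016/17). Provers cite these decls: `theorem foo : Summit.AnomalousDissipation.AnomalousDissipation.Theses.PumpedMirror.<Decl> := …` in Summits/AnomalousDissipation/AnomalousDissipation/Theorems/<Name>.lean.
-/

namespace Summit.AnomalousDissipation.AnomalousDissipation.Theses.PumpedMirror

open scoped BigOperators Topology Manifold Classical MeasureTheory ProbabilityTheory Matrix InnerProductSpace ComplexConjugate ContinuousMap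
open Filter Set Function TopologicalSpace MeasureTheory

attribute [summit_statement] _root_.AnomalousDissipation

open Literature.Turb

-- earlier MirrorCertificateTG (stmt-AnomalousDissipation-15550, replaced 2026-08-16T15:34:50Z -> stmt-AnomalousDissipation-15371): retired by None — ∀ f : UnitAddTorus (Fin 3) → EuclideanSpace ℝ (Fin 3), f = (fun x => !₂[(fourier 1 (x 0) : ℂ).im * (fourier 1 (x 1) : ℂ).re * (fourier 1 (x 2) : ℂ).re, -((fourier 1 (x 0) : ℂ).re * (fourier 1 (x 1) : ℂ).im * (fourier 1 (x 2) : ℂ).re), (0 : ℝ)]) → ∃ (E ε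
/-- item stmt-AnomalousDissipation-15371 · target · rank 0 · open · by planner
why it might fail: the two halves pull apart: a quiet bounded invariant K-state below the energy level reached from rest kills A at every E ≥ its energy, while B needs E at least the peak energy of the transient from rest.
sources: arXiv:1705.07096, arXiv:2010.06730, doi:10.1017/s0022112083001159, doi:10.1103/physreve.77.036306
X = A ∧ B at one common energy level E and viscosity threshold (for f = f_TG): low-energy mirror
floor certificate for every ν < ν₀ AND a mirror-symmetric global Leray–Hopf solution from rest
staying in {|u|² ≤ E} for every ν < ν₀. (rev 1, cone repair: the K-symmetry clause is written
coordinatewise, `… (Function.update x i (-x i)) j = if j = i then -(… x j) else … x j`,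
definitionally the former `mirrorReflection i` form by `mirrorReflection_apply`; meaning unchanged.) -/
@[route_item "route-AnomalousDissipation-PumpedMirror"]
def MirrorCertificateTG : Prop :=
  ∀ f : UnitAddTorus (Fin 3) → EuclideanSpace ℝ (Fin 3), f = (fun x => !₂[(fourier 1 (x 0) : ℂ).im * (fourier 1 (x 1) : ℂ).re * (fourier 1 (x 2) : ℂ).re, -((fourier 1 (x 0) : ℂ).re * (fourier 1 (x 1) : ℂ).im * (fourier 1 (x 2) : ℂ).re), (0 : ℝ)]) → ∃ (E ε₀ ν₀ : ℝ), 0 < E ∧ 0 < ε₀ ∧ 0 < ν₀ ∧ ∀ ν : ℝ, 0 < ν → ν < ν₀ → (∃ (Φ₁ : Literature.Analysis.FluidPDE.Torus.CylindricalTest (Fin 3)) (θ₁ : ℝ), θ₁ ≤ 0 ∧ ∀ u : Literature.Analysis.FunctionSpaces.Torus.energySpace (Fin 3), let uf : UnitAddTorus (Fin 3) → EuclideanSpace ℝ (Fin 3) := ((u : MeasureTheory.Lp (EuclideanSpace ℝ (Fin 3)) 2 (MeasureTheory.volume : MeasureTheory.Measure (UnitAddTorus (Fin 3)))) : UnitAddTorus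 (Fin 3) → EuclideanSpace ℝ (Fin 3)); let D : ℝ := ν * (Literature.Analysis.FunctionSpaces.Torus.eGradNormSq uf).toReal; let P : ℝ := Literature.Analysis.FluidPDE.Torus.pairing (u : MeasureTheory.Lp (EuclideanSpace ℝ (Fin 3)) 2 (MeasureTheory.volume : MeasureTheory.Measure (UnitAddTorus (Fin 3)))) f - D; (∀ i j : Fin 3, (fun x => uf (Function.update x i (-x i)) j) =ᵐ[MeasureTheory.volume] (fun x => if j = i then -(uf x j) else uf x j)) → Literature.Analysis.FunctionSpaces.Torus.eGradNormSq uf ≠ ⊤ → ‖u‖ ^ 2 ≤ E → ε₀ ≤ D + Literature.Analysis.FluidPDE.Torus.nsGeneratorPairing ν f u (Φ₁.grad u) + 2 * θ₁ * P) ∧ (∃ (u : ℝ → UnitAddTorus (Fin 3) → EuclideanSpace ℝ (Fin 3)) (U : ℝ → Literature.Analysis.FunctionSpaces.Torus.energySpace (Fin 3)), Literature.Analysis.FluidPDE.Torus.IsGlobalLerayHopf ν (fun _ => f) 0 u ∧ (∀ t, 0 ≤ t → ((U t : MeasureTheory.Lp (EuclideanSpace ℝ (Fin 3)) 2 (MeasureTheory.volume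 : MeasureTheory.Measure (UnitAddTorus (Fin 3)))) : UnitAddTorus (Fin 3) → EuclideanSpace ℝ (Fin 3)) =ᵐ[MeasureTheory.volume] u t) ∧ (∀ t, 0 ≤ t → ∀ i j : Fin 3, (fun x => ((U t : MeasureTheory.Lp (EuclideanSpace ℝ (Fin 3)) 2 (MeasureTheory.volume : MeasureTheory.Measure (UnitAddTorus (Fin 3)))) : UnitAddTorus (Fin 3) → EuclideanSpace ℝ (Fin 3)) (Function.update x i (-x i)) j) =ᵐ[MeasureTheory.volume] (fun x => if j = i then -(((U t : MeasureTheory.Lp (EuclideanSpace ℝ (Fin 3)) 2 (MeasureTheory.volume : MeasureTheory.Measure (UnitAddTorus (Fin 3)))) : UnitAddTorus (Fin 3) → EuclideanSpace ℝ (Fin 3)) x j) else ((U t : MeasureTheory.Lp (EuclideanSpace ℝ (Fin 3)) 2 (MeasureTheory.volume : MeasureTheory.Measure (UnitAddTorus (Fin 3)))) : UnitAddTorus (Fin 3) → EuclideanSpace ℝ (Fin 3)) x j)) ∧ (∀ t, 0 ≤ t → ‖U t‖ ^ 2 ≤ E))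

-- earlier MirrorFloorTG (stmt-AnomalousDissipation-15551, replaced 2026-08-16T15:34:50Z -> stmt-AnomalousDissipation-15372): retired by None — ∀ f : UnitAddTorus (Fin 3) → EuclideanSpace ℝ (Fin 3), f = (fun x => !₂[(fourier 1 (x 0) : ℂ).im * (fourier 1 (x 1) : ℂ).re * (fourier 1 (x 2) : ℂ).re, -((fourier 1 (x 0) : ℂ).re * (fourier 1 (x 1) : ℂ).im * (fourier 1 (x 2) : ℂ).re), (0 : ℝ)]) → ∀ E : ℝ, 0 <
/-- item stmt-AnomalousDissipation-15372 · crux · rank 2 · open · by planner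
why it might fail: ONE quiet bounded invariant K-state kills it: a steady corner line-jet of width √ν carrying the Kelvin flux 4/π at dissipation O(ν) (card K3's failure mode), a steady branch shadowing A(ν)·(planar TG cell) with A ~ ν^{-1/3}, or quiet eruption cycles below energy E.
sources: arXiv:1705.07096, arXiv:2010.06730, FMRTTurbulence2001, doi:10.1098/rsta.2013.0350, doi:10.1017/s0022112083001159, doi:10.1357/002224004774201681
LOW-ENERGY MIRROR FLOOR (from TaylorCertificates: the floor certificate and its PROVED pathwise
transfer; from kelvin-pump-symmetry-skeleton: the class where smooth dodgers cannot exist; new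
statement). For f = f_TG and EVERY energy level E > 0 there are ε₀, ν₀ > 0 such that for every ν ∈
(0,ν₀) ONE cylindrical test functional Φ₁ and weight θ₁ ≤ 0 satisfy ε₀ ≤ ν‖∇u‖² + ⟨F(u),Φ₁'(u)⟩ +
2θ₁((u,f_TG) − ν‖∇u‖²) at every finite-enstrophy state u ∈ H that is K-symmetric (a.e., on its
representative) with |u|² ≤ E. By minimax (Tobasco–Goluskin–Doering; Rosa–Temam) this says: at small
ν every (Galerkin-)invariant K-law of f_TG carried below energy E is ε₀(E)-loud — in particular NO
bounded quiet steady or recurrent K-state exists. [difficulty: open-problem] (rev 1, cone repair: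
the K-symmetry clause is written coordinatewise, `… (Function.update x i (-x i)) j = if j = i then
-(… x j) else … x j`, definitionally the former `mirrorReflection i` form by
`mirrorReflection_apply`; meaning unchanged.) -/
@[route_item "route-AnomalousDissipation-PumpedMirror", crux]
def MirrorFloorTG : Prop :=
  ∀ f : UnitAddTorus (Fin 3) → EuclideanSpace ℝ (Fin 3), f = (fun x => !₂[(fourier 1 (x 0) : ℂ).im * (fourier 1 (x 1) : ℂ).re * (fourier 1 (x 2) : ℂ).re, -((fourier 1 (x 0) : ℂ).re * (fourier 1 (x 1) : ℂ).im * (fourier 1 (x 2) : ℂ).re), (0 : ℝ)]) → ∀ E : ℝ, 0 < E → ∃ (ε₀ ν₀ : ℝ), 0 < ε₀ ∧ 0 < ν₀ ∧ ∀ ν : ℝ, 0 < ν → ν < ν₀ → ∃ (Φ₁ : Literature.Analysis.FluidPDE.Torus.CylindricalTest (Fin 3)) (θ₁ : ℝ), θ₁ ≤ 0 ∧ ∀ u : Literature.Analysis.FunctionSpaces.Torus.energySpace (Fin 3), let uf : UnitAddTorus (Fin 3) → EuclideanSpace ℝ (Fin 3) := ((u : MeasureTheory.Lp (EuclideanSpace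 ℝ (Fin 3)) 2 (MeasureTheory.volume : MeasureTheory.Measure (UnitAddTorus (Fin 3)))) : UnitAddTorus (Fin 3) → EuclideanSpace ℝ (Fin 3)); let D : ℝ := ν * (Literature.Analysis.FunctionSpaces.Torus.eGradNormSq uf).toReal; let P : ℝ := Literature.Analysis.FluidPDE.Torus.pairing (u : MeasureTheory.Lp (EuclideanSpace ℝ (Fin 3)) 2 (MeasureTheory.volume : MeasureTheory.Measure (UnitAddTorus (Fin 3)))) f - D; (∀ i j : Fin 3, (fun x => uf (Function.update x i (-x i)) j) =ᵐ[MeasureTheory.volume] (fun x => if j = i then -(uf x j) else uf x j)) → Literature.Analysis.FunctionSpaces.Torus.eGradNormSq uf ≠ ⊤ → ‖u‖ ^ 2 ≤ E → ε₀ ≤ D + Literature.Analysis.FluidPDE.Torus.nsGeneratorPairing ν f u (Φ₁.grad u) + 2 * θ₁ * P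

-- earlier MirrorBoundedFromRestTG (stmt-AnomalousDissipation-15552, replaced 2026-08-16T15:34:50Z -> stmt-AnomalousDissipation-15373): retired by None — ∀ f : UnitAddTorus (Fin 3) → EuclideanSpace ℝ (Fin 3), f = (fun x => !₂[(fourier 1 (x 0) : ℂ).im * (fourier 1 (x 1) : ℂ).re * (fourier 1 (x 2) : ℂ).re, -((fourier 1 (x 0) : ℂ).re * (fourier 1 (x 1) : ℂ).im * (fourier 1 (x 2) : ℂ).re), (0 : ℝ)]) → ∃ 
/-- item stmt-AnomalousDissipation-15373 · crux · rank 3 · open · by planner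
why it might fail: no ν-uniform sup-in-time energy bound is known for ANY fixed 3-D force, even from rest (a priori 16‖f‖²/ν² only); a transition delayed like log(1/ν), or a fat K-attractor (laminar-type branch E ~ ν^{-2a}) reached from rest, breaks it.
sources: DoeringFoias2002, FMRTTurbulence2001, doi:10.1103/physreve.77.036306, doi:10.1016/0169-5983(91)90026-f, arXiv:2311.04182
BOUNDED MIRROR FAMILY FROM REST (from FrustratedForces/DebrisQuanta/TaylorCertificatePair
refutations: the way of failing to avoid — no universal ceiling, no free datum, no drift; from
TaylorCertificates: ZeroDatumLerayHopf's lift-in-a-ball shape; new statement). For f = f_TG there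
are E, ν₁ > 0 such that for every ν ∈ (0,ν₁) SOME global Leray–Hopf solution of NS_ν(f_TG) from the
zero datum, with an H-lift U (U t = u t a.e., t ≥ 0) whose representatives are K-symmetric a.e.,
satisfies ‖U t‖² ≤ E for all t ≥ 0 — a PATHWISE, ν-uniform energy bound for the Taylor–Green flow
started from rest inside its symmetry class (zero momentum automatic; the only ν-independent energy
scale is F·L, the transient u ≈ t f_TG saturates at t ≈ F^{-1/2}). [difficulty: open-problem] (rev
1, cone repair: the K-symmetry clause is written coordinatewise, `… (Function.update x i (-x i)) j =
if j = i then -(… x j) else … x j`, definitionally the former `mirrorReflection i` form by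
`mirrorReflection_apply`; meaning unchanged.) -/
@[route_item "route-AnomalousDissipation-PumpedMirror", crux]
def MirrorBoundedFromRestTG : Prop :=
  ∀ f : UnitAddTorus (Fin 3) → EuclideanSpace ℝ (Fin 3), f = (fun x => !₂[(fourier 1 (x 0) : ℂ).im * (fourier 1 (x 1) : ℂ).re * (fourier 1 (x 2) : ℂ).re, -((fourier 1 (x 0) : ℂ).re * (fourier 1 (x 1) : ℂ).im * (fourier 1 (x 2) : ℂ).re), (0 : ℝ)]) → ∃ (E ν₁ : ℝ), 0 < E ∧ 0 < ν₁ ∧ ∀ ν : ℝ, 0 < ν → ν < ν₁ → ∃ (u : ℝ → UnitAddTorus (Fin 3) → EuclideanSpace ℝ (Fin 3)) (U : ℝ → Literature.Analysis.FunctionSpaces.Torus.energySpace (Fin 3)), Literature.Analysis.FluidPDE.Torus.IsGlobalLerayHopf ν (fun _ => f) 0 u ∧ (∀ t, 0 ≤ t → ((U t : MeasureTheory.Lp (EuclideanSpace ℝ (Fin 3)) 2 (MeasureTheory.volume : MeasureTheory.Measure (UnitAddTorus (Fin 3)))) : UnitAddTorus (Fin 3) → EuclideanSpace ℝ (Fin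 3)) =ᵐ[MeasureTheory.volume] u t) ∧ (∀ t, 0 ≤ t → ∀ i j : Fin 3, (fun x => ((U t : MeasureTheory.Lp (EuclideanSpace ℝ (Fin 3)) 2 (MeasureTheory.volume : MeasureTheory.Measure (UnitAddTorus (Fin 3)))) : UnitAddTorus (Fin 3) → EuclideanSpace ℝ (Fin 3)) (Function.update x i (-x i)) j) =ᵐ[MeasureTheory.volume] (fun x => if j = i then -(((U t : MeasureTheory.Lp (EuclideanSpace ℝ (Fin 3)) 2 (MeasureTheory.volume : MeasureTheory.Measure (UnitAddTorus (Fin 3)))) : UnitAddTorus (Fin 3) → EuclideanSpace ℝ (Fin 3)) x j) else ((U t : MeasureTheory.Lp (EuclideanSpace ℝ (Fin 3)) 2 (MeasureTheory.volume : MeasureTheory.Measure (UnitAddTorus (Fin 3)))) : UnitAddTorus (Fin 3) → EuclideanSpace ℝ (Fin 3)) x j)) ∧ (∀ t, 0 ≤ t → ‖U t‖ ^ 2 ≤ E)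

-- earlier NoSmoothMirrorDodgerTG (stmt-AnomalousDissipation-15553, replaced 2026-08-16T15:34:50Z -> stmt-AnomalousDissipation-15374): retired by None — ∀ f : UnitAddTorus (Fin 3) → EuclideanSpace ℝ (Fin 3), f = (fun x => !₂[(fourier 1 (x 0) : ℂ).im * (fourier 1 (x 1) : ℂ).re * (fourier 1 (x 2) : ℂ).re, -((fourier 1 (x 0) : ℂ).re * (fourier 1 (x 1) : ℂ).im * (fourier 1 (x 2) : ℂ).re), (0 : ℝ)]) → ∀ v
/-- item stmt-AnomalousDissipation-15374 · support · rank 9 · closed · proved by Summit.AnomalousDissipation.AnomalousDissipation.Theorems.PumpedMirrorNoSmoothMirrorDodgerTG.noSmoothMirrorDodgerTG (prover) · by planner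
sources: doi:10.1357/002224004774201681, doi:10.1017/S0022112056000123, doi:10.1017/s0022112083001159
KELVIN PUMP ⇒ NO SMOOTH MIRROR DODGER (card kelvin-pump-symmetry-skeleton K1, corollary (1);
provable now, M): no smooth divergence-free K-symmetric v satisfies ∫⟪(v·∇)v − f_TG, w⟫ = 0 for all
smooth divergence-free mean-zero w. Proof: the weak identity gives (v·∇)v − f_TG = ∇p + c with p
smooth (landed stub_strongForm p89280) and c constant; integrate the tangential component around C =
∂([0,½]²×{x₂=0}): on each edge v is tangent (normal components odd ⇒ 0) so ((v·∇)v)·t = ∂_s(v_s²/2)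
and v_s vanishes at the corners (odd + 1-periodic ⇒ v_s(½)=0), ∮∇p·dl = ∮c·dl = 0, but ∮ f_TG·dl =
4·(1/π) ≠ 0. This is exactly the hypothesis `hquiet` of
`KolmogorovFloor/Negative/QuietPointKill.floor_no_quiet_point` that can therefore never be met
inside Fix K for f_TG. [difficulty: provable-now] (rev 1, cone repair: the K-symmetry clause is
written coordinatewise, `… (Function.update x i (-x i)) j = if j = i then -(… x j) else … x j`,
definitionally the former `mirrorReflection i` form by `mirrorReflection_apply`; meaning unchanged.) -/
@[route_item "route-AnomalousDissipation-PumpedMirror"]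
def NoSmoothMirrorDodgerTG : Prop :=
  ∀ f : UnitAddTorus (Fin 3) → EuclideanSpace ℝ (Fin 3), f = (fun x => !₂[(fourier 1 (x 0) : ℂ).im * (fourier 1 (x 1) : ℂ).re * (fourier 1 (x 2) : ℂ).re, -((fourier 1 (x 0) : ℂ).re * (fourier 1 (x 1) : ℂ).im * (fourier 1 (x 2) : ℂ).re), (0 : ℝ)]) → ∀ v : UnitAddTorus (Fin 3) → EuclideanSpace ℝ (Fin 3), Literature.Analysis.FunctionSpaces.Torus.IsSmooth v → Literature.Analysis.FunctionSpaces.Torus.IsDivFree v → (∀ (i j : Fin 3) (x : UnitAddTorus (Fin 3)), v (Function.update x i (-x i)) j = if j = i then -(v x j) else v x j) → ¬ (∀ w : UnitAddTorus (Fin 3) → EuclideanSpace ℝ (Fin 3), Literature.Analysis.FunctionSpaces.Torus.IsSmooth w → Literature.Analysis.FunctionSpaces.Torus.IsDivFree w → Literature.Analysis.FunctionSpaces.Torus.HasZeroMean w → ∫ x, inner ℝ (Literature.Analysis.FunctionSpaces.Torus.convect v v x - f x) (w x) = 0)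

-- `NoSmoothMirrorDodgerTG` holds: proved by `Summit.AnomalousDissipation.AnomalousDissipation.Theorems.PumpedMirrorNoSmoothMirrorDodgerTG.noSmoothMirrorDodgerTG` (its module imports this route file, so no `_holds` link can be stated here).

-- earlier KelvinPumpSteadyTG (stmt-AnomalousDissipation-15554, replaced 2026-08-16T15:34:50Z -> stmt-AnomalousDissipation-15375): retired by None — ∀ f : UnitAddTorus (Fin 3) → EuclideanSpace ℝ (Fin 3), f = (fun x => !₂[(fourier 1 (x 0) : ℂ).im * (fourier 1 (x 1) : ℂ).re * (fourier 1 (x 2) : ℂ).re, -((fourier 1 (x 0) : ℂ).re * (fourier 1 (x 1) : ℂ).im * (fourier 1 (x 2) : ℂ).re), (0 : ℝ)]) → ∀ (ν : 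
/-- item stmt-AnomalousDissipation-15375 · support · rank 9 · closed · proved by Summit.AnomalousDissipation.AnomalousDissipation.Theorems.PumpedMirrorNoSmoothMirrorDodgerTG.kelvinPumpSteadyTG (prover) · by planner
sources: doi:10.1357/002224004774201681, doi:10.1017/S0022112056000123, doi:10.1017/jfm.2018.54
KELVIN PUMP IDENTITY FOR STEADY MIRROR STATES (card K1 (2), steady case; provable now, M): for every
ν and every smooth K-symmetric steady classical state (u,p) of NS_ν(f_TG) (time-constant
`IsClassicalNSSolutionOn univ`), ν·∮_C Δu·dl = −∮_C f_TG·dl = −4/π, the loop integral written as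
four interval integrals over s ∈ (0,½) of the tangential components of Δu along the edges {x₁=x₂=0},
{x₀=½,x₂=0}, {x₁=½,x₂=0} (reversed), {x₀=0,x₂=0} (reversed). The first exact ν-independent viscous
identity of the fixed-force problem in this class: every steady K-state carries 1/ν curvature on the
skeleton (a quiet bounded steady branch, if any, is a singular-perturbation object located in
advance). Same proof as NoSmoothMirrorDodgerTG plus the viscous term. [difficulty: provable-now]
(rev 1, cone repair: the K-symmetry clause is written coordinatewise, `… (Function.update x i (-x
i)) j = if j = i then -(… x j) else … x j`, definitionally the former `mirrorReflection i` form by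
`mirrorReflection_apply`; meaning unchanged.) -/
@[route_item "route-AnomalousDissipation-PumpedMirror"]
def KelvinPumpSteadyTG : Prop :=
  ∀ f : UnitAddTorus (Fin 3) → EuclideanSpace ℝ (Fin 3), f = (fun x => !₂[(fourier 1 (x 0) : ℂ).im * (fourier 1 (x 1) : ℂ).re * (fourier 1 (x 2) : ℂ).re, -((fourier 1 (x 0) : ℂ).re * (fourier 1 (x 1) : ℂ).im * (fourier 1 (x 2) : ℂ).re), (0 : ℝ)]) → ∀ (ν : ℝ) (u : UnitAddTorus (Fin 3) → EuclideanSpace ℝ (Fin 3)) (p : UnitAddTorus (Fin 3) → ℝ), Literature.Analysis.FunctionSpaces.Torus.IsClassicalNSSolutionOn Set.univ ν (fun _ => f) (fun _ => u) (fun _ => p) → (∀ (i j : Fin 3) (x : UnitAddTorus (Fin 3)), u (Function.update x i (-x i)) j = if j = i then -(u x j) else u x j) → ν * ((∫ s in (0 : ℝ)..(1 / 2), Literature.Analysis.FunctionSpaces.Torus.laplacian u (![((s : ℝ) : UnitAddCircle), ((0 : ℝ) : UnitAddCircle), ((0 : ℝ) : UnitAddCircle)]) 0) + (∫ s in (0 :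 ℝ)..(1 / 2), Literature.Analysis.FunctionSpaces.Torus.laplacian u (![(((1 / 2 : ℝ)) : UnitAddCircle), ((s : ℝ) : UnitAddCircle), ((0 : ℝ) : UnitAddCircle)]) 1) - (∫ s in (0 : ℝ)..(1 / 2), Literature.Analysis.FunctionSpaces.Torus.laplacian u (![((s : ℝ) : UnitAddCircle), (((1 / 2 : ℝ)) : UnitAddCircle), ((0 : ℝ) : UnitAddCircle)]) 0) - (∫ s in (0 : ℝ)..(1 / 2), Literature.Analysis.FunctionSpaces.Torus.laplacian u (![((0 : ℝ) : UnitAddCircle), ((s : ℝ) : UnitAddCircle), ((0 : ℝ) : UnitAddCircle)]) 1)) = -(4 / Real.pi)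

-- `KelvinPumpSteadyTG` holds: proved by `Summit.AnomalousDissipation.AnomalousDissipation.Theorems.PumpedMirrorNoSmoothMirrorDodgerTG.kelvinPumpSteadyTG` (its module imports this route file, so no `_holds` link can be stated here).

-- earlier MirrorSteadyStatesLoudTG (stmt-AnomalousDissipation-15555, replaced 2026-08-16T15:34:50Z -> stmt-AnomalousDissipation-15376): retired by None — ∀ f : UnitAddTorus (Fin 3) → EuclideanSpace ℝ (Fin 3), f = (fun x => !₂[(fourier 1 (x 0) : ℂ).im * (fourier 1 (x 1) : ℂ).re * (fourier 1 (x 2) : ℂ).re, -((fourier 1 (x 0) : ℂ).re * (fourier 1 (x 1) : ℂ).im * (fourier 1 (x 2) : ℂ).re), (0 : ℝ)]) → ∀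
/-- item stmt-AnomalousDissipation-15376 · support · rank 9 · open · by planner
sources: arXiv:1705.07096, doi:10.1017/s0022112083001159, Temam1979
LOW-ENERGY STEADY MIRROR STATES ARE LOUD — the cheapest necessary condition of crux #2, typed for
refuters and for K-symmetric Newton continuation (special case; TaylorCertificates'
TargetImpliesSteady pattern: at a smooth steady state the generator pairing and the energy channel
vanish, so the floor reads ε₀ ≤ ν‖∇u‖²): for f = f_TG and every E > 0 there are ε₀, ν₀ > 0 such that
for ν ∈ (0,ν₀) every smooth divergence-free pointwise-K-symmetric u solving the tested steady
equations ∫⟪νΔu − (u·∇)u + f_TG, w⟫ = 0 (w smooth div-free mean-zero) with ∫|u|² ≤ E has ν‖∇u‖² ≥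
ε₀. By KelvinPumpSteadyTG its quiet failure mode cannot be a ν-uniformly smooth branch. [difficulty:
L] (rev 1, cone repair: the K-symmetry clause is written coordinatewise, `… (Function.update x i (-x
i)) j = if j = i then -(… x j) else … x j`, definitionally the former `mirrorReflection i` form by
`mirrorReflection_apply`; meaning unchanged.) -/
@[route_item "route-AnomalousDissipation-PumpedMirror"]
def MirrorSteadyStatesLoudTG : Prop :=
  ∀ f : UnitAddTorus (Fin 3) → EuclideanSpace ℝ (Fin 3), f = (fun x => !₂[(fourier 1 (x 0) : ℂ).im * (fourier 1 (x 1) : ℂ).re * (fourier 1 (x 2) : ℂ).re, -((fourier 1 (x 0) : ℂ).re * (fourier 1 (x 1) : ℂ).im * (fourier 1 (x 2) : ℂ).re), (0 : ℝ)]) → ∀ E : ℝ, 0 < E → ∃ (ε₀ ν₀ : ℝ), 0 < ε₀ ∧ 0 < ν₀ ∧ ∀ ν : ℝ, 0 < ν → ν < ν₀ → ∀ u : UnitAddTorus (Fin 3) → EuclideanSpace ℝ (Fin 3), Literature.Analysis.FunctionSpaces.Torus.IsSmooth u → Literature.Analysis.FunctionSpaces.Torus.IsDivFree u → (∀ (i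 j : Fin 3) (x : UnitAddTorus (Fin 3)), u (Function.update x i (-x i)) j = if j = i then -(u x j) else u x j) → (∀ w : UnitAddTorus (Fin 3) → EuclideanSpace ℝ (Fin 3), Literature.Analysis.FunctionSpaces.Torus.IsSmooth w → Literature.Analysis.FunctionSpaces.Torus.IsDivFree w → Literature.Analysis.FunctionSpaces.Torus.HasZeroMean w → ∫ x, inner ℝ (ν • Literature.Analysis.FunctionSpaces.Torus.laplacian u x - Literature.Analysis.FunctionSpaces.Torus.convect u u x + f x) (w x) = 0) → ∫ x, ‖u x‖ ^ 2 ≤ E → ε₀ ≤ ν * Literature.Analysis.FunctionSpaces.Torus.gradNormSq u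

/-- item stmt-AnomalousDissipation-15377 · support · rank 9 · open · by planner
sources: FMRTTurbulence2001, arXiv:1705.07096, DoeringFoias2002
FLOOR TRANSFER ON A SET (provable now, M; rev 1 cone repair — carries the Leray–Hopf calculus of the
deciding theorem so that the route file imports only statement-level modules): for ν > 0, a smooth
steady force f, θ₁ ≤ 0, a cylindrical test functional Φ₁ and ANY set S ⊆ H — if the floor ε₀ ≤
ν‖∇v‖² + ⟨F(v),Φ₁'(v)⟩ + 2θ₁((v,f) − ν‖∇v‖²) holds at every finite-enstrophy v ∈ S with |v|² ≤ ρ,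
then every global Leray–Hopf solution u of NS_ν(f) from rest whose H-lift U (U t = u t a.e., t ≥ 0)
stays in S ∩ {|v|² ≤ ρ} has ε₀ ≤ meanDissipation ν u. Proof (attached as evidence, 120 lines, = the
`hDiss` block of rev-0 `closes`, commit e15693d98876, and TaylorCertificates' PROVED
Theorems/TaylorCertificatesFloorTransfer.lean with the ball replaced by a set): floor a.e. in t
along the lift (slices have finite enstrophy a.e.; eGradNormSq and the pairing only see the a.e.
class), integrate on (0,T], energy inequality from the zero datum ∫D ≤ ∫P with |P| ≤ √ρ‖f‖₂ and θ₁ ≤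
0, generator Cesàro mean → 0 (chain rule for the bounded Φ₁:
IsGlobalLerayHopf.tendsto_timeMean_generator), limsup comparison. [difficulty: provable-now] -/
@[route_item "route-AnomalousDissipation-PumpedMirror"]
def FloorTransferOnSetTG : Prop :=
  ∀ (ν ε₀ ρ θ₁ : ℝ) (f : UnitAddTorus (Fin 3) → EuclideanSpace ℝ (Fin 3)) (Φ₁ : Literature.Analysis.FluidPDE.Torus.CylindricalTest (Fin 3)) (S : Set (Literature.Analysis.FunctionSpaces.Torus.energySpace (Fin 3))) (u : ℝ → UnitAddTorus (Fin 3) → EuclideanSpace ℝ (Fin 3)) (U : ℝ → Literature.Analysis.FunctionSpaces.Torus.energySpace (Fin 3)), 0 < ν → θ₁ ≤ 0 → Literature.Analysis.FunctionSpaces.Torus.IsSmooth f → (∀ v ∈ S, let vf : UnitAddTorus (Fin 3) → EuclideanSpace ℝ (Fin 3) := ((v : MeasureTheory.Lp (EuclideanSpace ℝ (Fin 3)) 2 (MeasureTheory.volume : MeasureTheory.Measure (UnitAddTorus (Fin 3)))) : UnitAddTorus (Fin 3) → EuclideanSpace ℝ (Fin 3)); let D : ℝ := ν * (Literature.Analysis.FunctionSpaces.Torus.eGradNormSq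 vf).toReal; Literature.Analysis.FunctionSpaces.Torus.eGradNormSq vf ≠ ⊤ → ‖v‖ ^ 2 ≤ ρ → ε₀ ≤ D + Literature.Analysis.FluidPDE.Torus.nsGeneratorPairing ν f v (Φ₁.grad v) + 2 * θ₁ * (Literature.Analysis.FluidPDE.Torus.pairing (v : MeasureTheory.Lp (EuclideanSpace ℝ (Fin 3)) 2 (MeasureTheory.volume : MeasureTheory.Measure (UnitAddTorus (Fin 3)))) f - D)) → Literature.Analysis.FluidPDE.Torus.IsGlobalLerayHopf ν (fun _ => f) 0 u → (∀ t, 0 ≤ t → ((U t : MeasureTheory.Lp (EuclideanSpace ℝ (Fin 3)) 2 (MeasureTheory.volume : MeasureTheory.Measure (UnitAddTorus (Fin 3)))) : UnitAddTorus (Fin 3) → EuclideanSpace ℝ (Fin 3)) =ᵐ[MeasureTheory.volume] u t) → (∀ t, 0 ≤ t → U t ∈ S) → (∀ t, 0 ≤ t → ‖U t‖ ^ 2 ≤ ρ) → ε₀ ≤ Literature.Analysis.FluidPDE.meanDissipation ν u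

/-- item stmt-AnomalousDissipation-15378 · support · rank 9 · closed · proved by Summit.AnomalousDissipation.AnomalousDissipation.Theorems.pumpedMirror_taylorGreenForceRegularTG_proof @ 40132f2965d1 (prover) · by planner
sources: doi:10.1017/s0022112083001159, Temam1979
f_TG IS AN ADMISSIBLE FORCE (provable now, S; rev 1 cone repair — split out of the deciding theorem
so that the route file does not import MirrorVariety's negative anatomy): the pinned Taylor–Green
force is smooth, divergence free and mean zero — a real trigonometric polynomial on the shell {±1}³
with transversal, conjugate-symmetric coefficients f̂(k) = (i/8)(−k₀, k₁, 0). Landed verbatim for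
the same lambda term as `isSmooth_tgForce`, `isDivFree_tgForce`, `hasZeroMean_tgForce`
(Theorems/TaylorGreenLoudGalerkinStates/Negative/Anatomy.lean); 3-line proof attached as evidence.
[difficulty: provable-now] -/
@[route_item "route-AnomalousDissipation-PumpedMirror"]
def TaylorGreenForceRegularTG : Prop :=
  ∀ f : UnitAddTorus (Fin 3) → EuclideanSpace ℝ (Fin 3), f = (fun x => !₂[(fourier 1 (x 0) : ℂ).im * (fourier 1 (x 1) : ℂ).re * (fourier 1 (x 2) : ℂ).re, -((fourier 1 (x 0) : ℂ).re * (fourier 1 (x 1) : ℂ).im * (fourier 1 (x 2) : ℂ).re), (0 : ℝ)]) → Literature.Analysis.FunctionSpaces.Torus.IsSmooth f ∧ Literature.Analysis.FunctionSpaces.Torus.IsDivFree f ∧ Literature.Analysis.FunctionSpaces.Torus.HasZeroMean f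

-- `TaylorGreenForceRegularTG` holds: proved by `Summit.AnomalousDissipation.AnomalousDissipation.Theorems.pumpedMirror_taylorGreenForceRegularTG_proof` @ 40132f2965d1 (its module imports this route file, so no `_holds` link can be stated here).

/-- item stmt-AnomalousDissipation-15556 · support · rank 9 · open · by planner
sources: arXiv:1705.07096
[support] glue, PROVED in the planner's Sketch.lean (`cruxesGiveTarget_holds`, 6 lines):
MirrorFloorTG → MirrorBoundedFromRestTG → MirrorCertificateTG (take E, ν₁ from B, instantiate A at
E, ν₀ := min). [difficulty: provable-now] -/
@[route_item "route-AnomalousDissipation-PumpedMirror"]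
def CruxesGiveTargetTG : Prop :=
  MirrorFloorTG → MirrorBoundedFromRestTG → MirrorCertificateTG

/-- item stmt-AnomalousDissipation-15557 · assembly · rank 1 · open · by planner
sources: FMRTTurbulence2001, arXiv:1705.07096
[assembly] MirrorFloorTG → MirrorBoundedFromRestTG → AnomalousDissipation (identical to the
certified `closes`). -/
@[route_item "route-AnomalousDissipation-PumpedMirror"]
def Assembly : Prop :=
  MirrorFloorTG → MirrorBoundedFromRestTG → _root_.AnomalousDissipation

/-! D-0027 §2.1 — DECIDING THEOREM (planner-authored via `route open/edit --closes-file`; by planner-rrepair-AnomalousDissipation-PumpedMir-f9e8cabf-0 2026-08-16T15:59:47Z):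
its hypotheses are this route's items and its conclusion the sub-problem Statement (glue_lint), and it elaborates with this file. -/

@[closes "route-AnomalousDissipation-PumpedMirror"] theorem closes : MirrorFloorTG → MirrorBoundedFromRestTG → _root_.AnomalousDissipation := by
 intro hA hB
 set fTG : UnitAddTorus (Fin 3) → EuclideanSpace ℝ (Fin 3) :=
  (fun x => !₂[(fourier 1 (x 0) : ℂ).im * (fourier 1 (x 1) : ℂ).re * (fourier 1 (x 2) : ℂ).re,
   -((fourier 1 (x 0) : ℂ).re * (fourier 1 (x 1) : ℂ).im * (fourier 1 (x 2) : ℂ).re), (0 : ℝ)]) with hfTG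
 set S : Finset (Fin 3 → ℤ) := Fintype.piFinset fun _ : Fin 3 => ({1, -1} : Finset ℤ) with hS
 set C : (Fin 3 → ℤ) → EuclideanSpace ℂ (Fin 3) :=
  fun k => ((8⁻¹ : ℝ) : ℂ) • !₂[-(Complex.I * (k 0 : ℂ)), Complex.I * (k 1 : ℂ), 0] with hC
 have hsp : ∀ g : Fin 3 → ℤ → ℂ, ∑ k ∈ S, ∏ j, g j (k j) = ∏ j, (g j 1 + g j (-1)) := by
  intro g
  rw [hS, ← Finset.prod_univ_sum]
  exact Finset.prod_congr rfl fun j _ => Finset.sum_pair (by decide)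
 have hmF3 : ∀ (k : Fin 3 → ℤ) (x : UnitAddTorus (Fin 3)),
   UnitAddTorus.mFourier k x = fourier (k 0) (x 0) * fourier (k 1) (x 1) * fourier (k 2) (x 2) := by
  intro k x; simp [UnitAddTorus.mFourier, Fin.prod_univ_three]
 have ha0 : ∀ x : UnitAddTorus (Fin 3), (∑ k ∈ S, UnitAddTorus.mFourier k x * C k 0).re = fTG x 0 := by
  intro x
  have h : ∀ k ∈ S, UnitAddTorus.mFourier k x * C k 0 =
    ∏ j, (![fun a : ℤ => fourier a (x 0) * (((8⁻¹ : ℝ) : ℂ) * -(Complex.I * (a : ℂ))),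
     fun a : ℤ => (fourier a (x 1) : ℂ), fun a : ℤ => (fourier a (x 2) : ℂ)] : Fin 3 → ℤ → ℂ) j (k j) := by
   intro k _
   rw [hmF3, Fin.prod_univ_three]
   simp [hC]
   ring
  rw [Finset.sum_congr rfl h, hsp, Fin.prod_univ_three]
  simp only [Matrix.cons_val_zero, Matrix.cons_val_one, Matrix.cons_val_two, Matrix.head_cons, Matrix.tail_cons,
   fourier_neg, Int.cast_one, Int.cast_neg, hfTG, PiLp.toLp_apply]
  simp only [Complex.mul_re, Complex.mul_im, Complex.add_re, Complex.add_im, Complex.neg_re, Complex.neg_im,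
   Complex.conj_re, Complex.conj_im, Complex.I_re, Complex.I_im, Complex.ofReal_re, Complex.ofReal_im,
   Complex.one_re, Complex.one_im, zero_mul, sub_zero, zero_sub, add_zero, zero_add, mul_one, one_mul]
  ring
 have ha1 : ∀ x : UnitAddTorus (Fin 3), (∑ k ∈ S, UnitAddTorus.mFourier k x * C k 1).re = fTG x 1 := by
  intro x
  have h : ∀ k ∈ S, UnitAddTorus.mFourier k x * C k 1 =
    ∏ j, (![fun a : ℤ => (fourier a (x 0) : ℂ),
     fun a : ℤ => fourier a (x 1) * (((8⁻¹ : ℝ) : ℂ) * (Complex.I * (a : ℂ))),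
     fun a : ℤ => (fourier a (x 2) : ℂ)] : Fin 3 → ℤ → ℂ) j (k j) := by
   intro k _
   rw [hmF3, Fin.prod_univ_three]
   simp [hC]
   ring
  rw [Finset.sum_congr rfl h, hsp, Fin.prod_univ_three]
  simp only [Matrix.cons_val_zero, Matrix.cons_val_one, Matrix.cons_val_two, Matrix.head_cons, Matrix.tail_cons,
   fourier_neg, Int.cast_one, Int.cast_neg, hfTG, PiLp.toLp_apply]
  simp only [Complex.mul_re, Complex.mul_im, Complex.add_re, Complex.add_im, Complex.neg_re, Complex.neg_im,
   Complex.conj_re, Complex.conj_im, Complex.I_re, Complex.I_im, Complex.ofReal_re, Complex.ofReal_im,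
   Complex.one_re, Complex.one_im, zero_mul, sub_zero, zero_sub, add_zero, zero_add, mul_one, one_mul]
  ring
 have ha2 : ∀ x : UnitAddTorus (Fin 3), (∑ k ∈ S, UnitAddTorus.mFourier k x * C k 2).re = fTG x 2 :=
  fun x => by simp [hC, hfTG]
 have hpoly : fTG = Literature.Analysis.FunctionSpaces.Torus.realTrigPoly S C := by
  funext x
  ext i
  rw [Literature.Analysis.FunctionSpaces.Torus.realTrigPoly_apply_coord, Literature.Analysis.FunctionSpaces.Torus.trigPoly_apply_coord]
  fin_cases i
  · exact (ha0 x).symm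
  · exact (ha1 x).symm
  · exact (ha2 x).symm
 have hS0 : (0 : Fin 3 → ℤ) ∉ S := by
  rw [hS, Fintype.mem_piFinset]; intro h; simpa using h 0
 have hsq : ∀ k ∈ S, ∀ j : Fin 3, (k j : ℂ) ^ 2 = 1 := fun k hk j => by
  rcases Finset.mem_insert.1 (Fintype.mem_piFinset.1 (hS ▸ hk) j) with h | h
  · simp [h]
  · simp [Finset.mem_singleton.1 h]
 have htr : Literature.Analysis.FunctionSpaces.Torus.IsTransversal S C := by
  intro k hk
  have e0 := hsq k hk 0
  have e1 := hsq k hk 1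
  simp only [hC, Fin.sum_univ_three, PiLp.smul_apply, smul_eq_mul, Matrix.cons_val_zero,
   Matrix.cons_val_one, Matrix.cons_val_two, Matrix.head_cons, Matrix.tail_cons]
  linear_combination (((8⁻¹ : ℝ) : ℂ) * Complex.I) * (e1 - e0)
 have hfs : Literature.Analysis.FunctionSpaces.Torus.IsSmooth fTG := hpoly ▸ Literature.Analysis.FunctionSpaces.Torus.isSmooth_realTrigPoly _ _
 have hfd : Literature.Analysis.FunctionSpaces.Torus.IsDivFree fTG := hpoly ▸ Literature.Analysis.FunctionSpaces.Torus.isDivFree_realTrigPoly htr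
 have hfz : Literature.Analysis.FunctionSpaces.Torus.HasZeroMean fTG := by
  rw [hpoly]
  show ∫ x, Literature.Analysis.FunctionSpaces.EuclideanSpace.realPart (Literature.Analysis.FunctionSpaces.Torus.trigPoly S C x) = 0
  rw [ContinuousLinearMap.integral_comp_comm _ (Literature.Analysis.FunctionSpaces.Torus.continuous_trigPoly S C).integrable_unitAddTorus]
  have h : ∫ x, Literature.Analysis.FunctionSpaces.Torus.trigPoly S C x = 0 := by
   simp_rw [Literature.Analysis.FunctionSpaces.Torus.trigPoly_apply]
   have hint : ∀ k ∈ S, Integrable (fun x : UnitAddTorus (Fin 3) => UnitAddTorus.mFourier k x • C k) volume :=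
    fun k _ => ((UnitAddTorus.mFourier k).continuous.smul continuous_const).integrable_unitAddTorus
   rw [integral_finsetSum _ hint]
   refine Finset.sum_eq_zero fun k hk => ?_
   have hk0 : k ≠ 0 := fun h => hS0 (h ▸ hk)
   rw [integral_smul_const, Literature.Analysis.FunctionSpaces.Torus.integral_mFourier, if_neg hk0, zero_smul]
  rw [h, map_zero]
 have hfL2 : MemLp fTG 2 (volume : Measure (UnitAddTorus (Fin 3))) := hfs.memLp 2
 obtain ⟨E, ν₁, hE, hν₁, hfam⟩ := hB fTG hfTG
 obtain ⟨ε₀, ν₀, hε₀, hν₀, hfl⟩ := hA fTG hfTG E hE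
 have hm : 0 < min ν₀ ν₁ := lt_min hν₀ hν₁
 set ν : ℕ → ℝ := fun j => min ν₀ ν₁ / ((j : ℝ) + 2) with hν
 have hνp : ∀ j, 0 < ν j := fun j => div_pos hm (by positivity)
 have hνlt : ∀ j, ν j < min ν₀ ν₁ := fun j => by
  rw [div_lt_iff₀ (by positivity : (0 : ℝ) < j + 2)]; nlinarith
 have hνlim : Tendsto ν atTop (nhds 0) := by
  simpa [hν, div_eq_mul_inv] using (tendsto_inv_atTop_zero.comp
   (tendsto_atTop_add_const_right atTop (2 : ℝ) tendsto_natCast_atTop_atTop)).const_mul (min ν₀ ν₁)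
 choose u U hLH hl hsym hbd using fun j => hfam (ν j) (hνp j) ((hνlt j).trans_le (min_le_right _ _))
 choose Φ θ hθ hflo using fun j => hfl (ν j) (hνp j) ((hνlt j).trans_le (min_le_left _ _))
 have hEn : ∀ j, Literature.Analysis.FluidPDE.meanEnergy (u j) ≤ E := by
  intro j
  have hg : ∀ t, 0 ≤ t → |∫ x, ‖u j t x‖ ^ 2| ≤ E := by
   intro t ht
   have h1 : ‖U j t‖ ^ 2 = ∫ x, ‖u j t x‖ ^ 2 := by
    rw [Submodule.coe_norm, ← real_inner_self_eq_norm_sq, L2.inner_def]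
    refine integral_congr_ae ?_
    filter_upwards [hl j t ht] with x hx
    rw [hx, real_inner_self_eq_norm_sq]
   rw [abs_of_nonneg (integral_nonneg fun x => by positivity), ← h1]
   exact hbd j t ht
  have hTM : ∀ T, 0 < T → |Literature.Analysis.FluidPDE.timeMean (fun t => ∫ x, ‖u j t x‖ ^ 2) T| ≤ E :=
   fun T hT => Literature.Analysis.FluidPDE.abs_timeMean_le hT fun t ht _ => hg t ht.le
  rw [Literature.Analysis.FluidPDE.meanEnergy_eq_longTimeAvgSup]
  exact limsup_le_of_le
   (isCoboundedUnder_le_of_eventually_le atTop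
    ((eventually_gt_atTop 0).mono fun T hT => (abs_le.1 (hTM T hT)).1))
   ((eventually_gt_atTop 0).mono fun T hT => (abs_le.1 (hTM T hT)).2)
 have hDiss : ∀ j, ε₀ ≤ Literature.Analysis.FluidPDE.meanDissipation (ν j) (u j) := by
  intro j
  set D : ℝ → ℝ := fun t => ν j * (Literature.Analysis.FunctionSpaces.Torus.eGradNormSq (u j t)).toReal
  set G : ℝ → ℝ := fun t => Literature.Analysis.FluidPDE.Torus.nsGeneratorPairing (ν j) fTG (U j t) ((Φ j).grad (U j t))
  set P : ℝ → ℝ := fun t => ∫ x, inner ℝ (fTG x) (u j t x)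
  set K : ℝ := 2 * ((4 * Real.pi ^ 2 * ν j)⁻¹ / 2 * ∫ x, ‖fTG x‖ ^ 2) with hK
  have hPt : ∀ t, 0 ≤ t → Literature.Analysis.FluidPDE.Torus.pairing (U j t).1 fTG = P t := fun t ht0 => by
   rw [Literature.Analysis.FluidPDE.Torus.pairing_lift_eq (hl j) fTG ht0]
   exact integral_congr_ae (ae_of_all _ fun x => real_inner_comm _ _)
  have hAE : ∀ T, 0 < T → ∀ᵐ t ∂(volume.restrict (Ioc 0 T)), ε₀ ≤ D t + G t + 2 * θ j * (P t - D t) := by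
   intro T hT
   have hL := hLH j T hT
   have hae := ae_lt_top' hL.aemeasurable_eGradNormSq hL.lintegral_eGradNormSq_lt_top.ne
   rw [← Measure.restrict_congr_set (Ioo_ae_eq_Ioc (μ := (volume : Measure ℝ)))]
   filter_upwards [hae, ae_restrict_mem measurableSet_Ioo] with t ht htmem
   have ht0 : 0 ≤ t := htmem.1.le
   have hcg : Literature.Analysis.FunctionSpaces.Torus.eGradNormSq ((U j t).1 : UnitAddTorus (Fin 3) → EuclideanSpace ℝ (Fin 3)) =
     Literature.Analysis.FunctionSpaces.Torus.eGradNormSq (u j t) := by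
    unfold Literature.Analysis.FunctionSpaces.Torus.eGradNormSq Literature.Analysis.FunctionSpaces.Torus.eHomSobolevSeminorm
    simp_rw [Literature.Analysis.FunctionSpaces.Torus.mFourierCoeff_congr_ae ((hl j t ht0).fun_comp _)]
   have h := hflo j (U j t) (hsym j t ht0) (by rw [hcg]; exact ht.ne) (hbd j t ht0)
   rw [hcg, hPt t ht0] at h
   exact h
  have key : ∀ T, 0 < T → ε₀ ≤ Literature.Analysis.FluidPDE.timeMean D T + Literature.Analysis.FluidPDE.timeMean G T ∧ Literature.Analysis.FluidPDE.timeMean D T ≤ K := by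
   intro T hT
   have hL := hLH j T hT
   have hDI : IntegrableOn D (Ioc 0 T) :=
    (intervalIntegrable_iff_integrableOn_Ioc_of_le hT.le).1 (hL.intervalIntegral_dissipation_eq hT).1
   have hGI : IntegrableOn G (Ioc 0 T) := (hLH j).integrableOn_generator hfL2 (hl j) (Φ j) hT
   have hPI : IntegrableOn P (Ioc 0 T) :=
    (intervalIntegrable_iff_integrableOn_Ioc_of_le hT.le).1 (hL.intervalIntegrable_power hT (hνp j) hfL2 hfz)
   have hI : ∫ _ in Ioc 0 T, ε₀ ≤ ∫ t in Ioc 0 T, (D t + G t + 2 * θ j * (P t - D t)) :=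
    integral_mono_ae (integrable_const _) ((hDI.add hGI).add ((hPI.sub hDI).const_mul _)) (hAE T hT)
   rw [setIntegral_const, Real.volume_real_Ioc_of_le hT.le, sub_zero, smul_eq_mul,
    integral_add (f := fun t => D t + G t) (g := fun t => 2 * θ j * (P t - D t)) (hDI.add hGI)
     ((hPI.sub hDI).const_mul _), integral_add hDI hGI, integral_const_mul (2 * θ j) (fun t => P t - D t),
    integral_sub hPI hDI] at hI
   have hEn := hL.intervalIntegral_dissipation_le hT
   obtain ⟨hDb, -⟩ := hL.intervalIntegral_power_bounds hT (hνp j) hfL2 hfz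
   have hK0 : Literature.Analysis.FunctionSpaces.Torus.kineticEnergy (0 : UnitAddTorus (Fin 3) → EuclideanSpace ℝ (Fin 3)) = 0 := by
    simp [Literature.Analysis.FunctionSpaces.Torus.kineticEnergy]
   rw [hK0, intervalIntegral.integral_of_le hT.le, intervalIntegral.integral_of_le hT.le] at hEn
   rw [hK0, mul_zero, zero_add, ← hK, intervalIntegral.integral_of_le hT.le] at hDb
   have hchan : 2 * θ j * ((∫ t in Ioc 0 T, P t) - ∫ t in Ioc 0 T, D t) ≤ 0 := by
    have h1 : 0 ≤ (∫ t in Ioc 0 T, P t) - ∫ t in Ioc 0 T, D t := by linarith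
    nlinarith [hθ j]
   simp only [Literature.Analysis.FluidPDE.timeMean, intervalIntegral.integral_of_le hT.le]
   constructor
   · rw [← mul_add, le_inv_mul_iff₀ hT]; linarith
   · rw [inv_mul_le_iff₀ hT]; linarith
  have hlow : Tendsto (fun T : ℝ => ε₀ - Literature.Analysis.FluidPDE.timeMean G T) atTop (nhds ε₀) := by
   simpa using ((hLH j).tendsto_timeMean_generator hfL2 (hl j) (Φ j)).const_sub ε₀
  have hle : ∀ᶠ T in atTop, ε₀ - Literature.Analysis.FluidPDE.timeMean G T ≤ Literature.Analysis.FluidPDE.timeMean D T :=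
   (eventually_gt_atTop 0).mono fun T hT => by linarith [(key T hT).1]
  have hDle : ∀ᶠ T in atTop, Literature.Analysis.FluidPDE.timeMean D T ≤ K := (eventually_gt_atTop 0).mono fun T hT => (key T hT).2
  calc ε₀ = limsup (fun T : ℝ => ε₀ - Literature.Analysis.FluidPDE.timeMean G T) atTop := hlow.limsup_eq.symm
   _ ≤ limsup (Literature.Analysis.FluidPDE.timeMean D) atTop :=
     limsup_le_limsup hle hlow.isBoundedUnder_ge.isCoboundedUnder_le (isBoundedUnder_of_eventually_le hDle)
   _ = Literature.Analysis.FluidPDE.meanDissipation (ν j) (u j) := rfl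
 exact ⟨fTG, hfs, hfd, hfz, ν, fun _ => 0, u, hνp, hνlim, hLH, ⟨E, hEn⟩, ε₀, hε₀, hDiss⟩

end Summit.AnomalousDissipation.AnomalousDissipation.Theses.PumpedMirror
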